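import Literature.NumberTheory.EllipticCurves.Rank1Residual.Predicates
import Literature.NumberTheory.EllipticCurves.Rank1Residual.PrintShape
import Literature.NumberTheory.EllipticCurves.Wuthrich2014.ShaBoundProofs
import Literature.NumberTheory.EllipticCurves.SkinnerZhang2014.MultiplicativeIndivisibility
import Literature.NumberTheory.EllipticCurves.Castella2018.MultiplicativePPartErratum
import HarnessLib

/-!
# BSD in analytic rank `≤ 1`, residual class X11 (multiplicative `p`, irreducible `E[p]`), primes `p ≥ 5`: what published theorems delete, and what only announced statements reach

HONEST FRAMING (cell `b2b-bsdres`, `run/shared/lean/b2b/bsd-rank1-residual/`): the goal of the cell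
is to DELETE the COMBINATION-SHAPED residual classes of the BSD formula for ALL analytic-rank `≤ 1`
elliptic curves over `ℚ` — "full BSD formula for every rank `≤ 1` curve in class `C`" assembled
STRICTLY from published theorems — so that the remainder becomes exactly the CONSTRUCTION-SHAPED
classes, which are TYPED (missing-input `Prop`s), NOT attempted. This is not "finishing BSD". No
internally-minted statement is a cited fact; an announced / unrefereed statement enters only as an
explicitly labelled OPEN hypothesis (`…_OPEN` binders below), and a theorem taking one is
CONDITIONAL.

THEOREMS ONLY. Class: `ClassX11 W p` of `Predicates.lean` = RESIDUAL-CASES.md §a.2 row X11,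
"`mult(p) ∧ irr(p) ∧ [¬ram(p) ∨ (r = 1 ∧ ¬sst) ∨ (r = 1 ∧ p = 3)]`"; this file treats `p ≠ 3`
(the `p = 3` clause is `X11Three.lean`). Currency: Miller's `BSD(E,p)` = `BSDp W p`.

## Audit (prover A, 2026-08-18; all quotations from the texts read, locators given)

PUBLISHED pieces and their printed hypotheses at a multiplicative prime `p ≥ 5`:
* Skinner, Pacific J. Math. 283 (2016) 171–200, Thm. C (rank `0`): "(ii) there exists a prime
  `q ≠ p` at which `E` has multiplicative reduction and `E[p]` is ramified" = `Ram W p`. (Tree: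
  `Skinner2016/RankZeroPPart.lean`.)
* Burungale–Castella–Skinner, IMRN 2025 rnaf082 = arXiv:2405.00270v2 — the ONLY published removal
  of the auxiliary prime — Thm. 1.1.2 (p. 2): "Let `E` be an elliptic curve defined over `ℚ` and `p`
  a prime of good ordinary reduction for `E`"; Cor. 1.3.1 (p. 4): "Let `p > 3` be a prime of good
  ordinary reduction such that (irr_ℚ) and (im) hold"; its engine Thm. 3.2.1 (Wan; p. 7): "let
  `p > 3` be a prime of good ordinary reduction for `g`". ⇒ BCS says nothing at `p ‖ N`
  (`ClassX11.not_good`).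
* W. Zhang, Camb. J. Math. 2 (2014) 191–253 (lever L4 of the census), p. 193: "Throughout this
  paper we assume that `ρ̄_{E,p}` is surjective, `p ∤ N`, and `p ≥ 5`"; Thm. 1.4 (4), p. 197: "The
  prime `p` is good ordinary." ⇒ reaches NO pair of X11 (`ClassX11.not_good`); the requested
  `bsd_p_of_X11_zhang` has empty scope and is not stated. Likewise Yan–Zhu, J. Algebra (2026)
  Thm. 4.15 and Jetchev–Skinner–Wan 2017 Thm. 1.2.1 (good `p`).
* Castella, Camb. J. Math. 6 (2018) 1–23, Thm. A (rank `1`; census row T-CAS): "Let `E/ℚ` be a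
  semistable elliptic curve … If `p ∣ N`, assume in addition that `E[p]` is ramified at some prime
  `q ≠ p`" — needs `Semistable W` AND `Ram W p`; moreover its printed proof at `p ‖ N` is WITHDRAWN
  by the author's erratum (web, n.d.; "Theorem 4.4 in [Cas18] should be replaced by Theorem 1.1
  below … Theorem A′ … should replace the main Theorem A in op. cit. when `p ∥ N`"), so it is NOT a
  tree fact (see `LeadingTermPPartRankLeOne.lean`, "NOT vendored", and
  `Castella2018/MultiplicativePPartErratum.lean`).
* R. L. Miller, LMS J. Comput. Math. 14 (2011) Thm. 1.2 (+ Lawson–Wuthrich 2016 §5): `BSD(E,p)`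
  for ALL `E` with `r_an ≤ 1`, `N_E < 5000`, `E[p]` irreducible — a finite sub-class, in print
  (`bsdp_of_classX11_of_conductor_lt`).
* C. Wuthrich, Doc. Math. 19 (2014) Prop. 21: `#Ш ∣ C · #Ш_an` with `p ∤ C` at an odd
  non-additive `p` with `ρ̄_{E,p}` surjective or reducible ⇒ the rank-`0` sub-class
  `surj(p) ∧ ord_p #Ш_an = 0` (lever L1; `bsdp_of_classX11_rankZero_surj_of_shaAn_unit`).

ANNOUNCED / UNREFEREED statements reaching parts of X11 at `p ≥ 5` (OPEN binders):
* Castella's erratum, Thm. A′ (`Castella2018.erratum_thmAprime_padicVal_bsd_rankOne_OPEN`):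
  rank `1`, multiplicative `p > 3`, irr, a NONSPLIT multiplicative `q ≠ p` with `E[p]` ramified,
  `E(ℚ_p)[p] = 0`, ANY `N` (semistability dropped) — proof via Fouquet–Wan arXiv:2107.13726
  Thm. 4.41 (unrefereed). Reaches part of the disjunct `r = 1 ∧ ¬sst`, never `¬ram`
  (`ram_of_erratumAprime_hypothesis`).
* Skinner–Zhang, arXiv:1407.1099v1 (2014) Thm. 1.2 (`SkinnerZhang2014.thm1_2_…_OPEN`): rank `1`,
  `p ≥ 5`, hypotheses (a)–(e), `N` arbitrary — never `¬ram` ((e) + `ℓ ≠ p`: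
  `ram_of_skinnerZhang_hypotheses`).

VERDICT PROPOSED TO THE REFEREE (R4). (i) `X11 ∧ ¬ram(p)`, `p ≥ 5`, both ranks (104 of the 221
census pairs `N < 10⁴` have no (ram) witness; e.g. `N = p`): NOT DELETABLE from published pieces,
and not even reached by an announced statement; missing published piece = a (ram)-free INTEGRAL
cyclotomic main-conj. / Kolyvagin-system argument at `p ‖ N` (the `p ‖ N` transplant of BCS 2025;
cf. the tree's line `Summits/BirchSwinnertonDyer/BirchSwinnertonDyer/Cruxes/KatoDivisibility/Lines/
RungMultSelfAux.lean`, stubs `stub_lower_noinert_ge5/three`); per curve only (Kolyvagin index C11,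
Wuthrich L1, Kim AJM 2026 L5, Miller for `N < 5000`). (ii) `X11 ∧ r = 1 ∧ ¬sst ∧ ram(p)`, `p ≥ 5`:
reached ONLY by unrefereed statements (A′; SZ Thm. 1.2) and only on the sub-locus of their side
conditions (the lane's computation `HOME/b2b-bsdres-x11b/aprime_side_conditions_j039928.tsv`: A′'s
hold for 5 of the 10 census pairs `N < 10⁴` — 3060h1, 3465d1, 4590o1, 7110m1 @5, 5824c1@7 — and
fail for 2760k1, 4230bg1, 6240be1 @5, 9954j1@7, 8670u1@5 (¬ram)) ⇒ CONDITIONAL at best. (iii) The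
covered-class row C4/T-CAS (`r = 1 ∧ sst ∧ mult ∧ irr ∧ ram ∧ p > 3`) has lost its published source
at `p ‖ N` (erratum) and is reached by the same unrefereed statements: 12 census pairs `N < 10⁴`
(430d1@5, 1155k1@7, 1590i1@5, 2090c1@5, 2990g1@5, 3045j1@5, 4485d1@5, 4830y1@5, 6045f1@5,
7259d1@7, 8610h1@5, 9930q1@5), of which 3045j1@5 and 8610h1@5 fail A′'s side conditions (x11b,
job j039928) — 3045j1 is still in print by Miller (`N < 5000`).
-/

noncomputable section

open scoped Classical

open WeierstrassCurve
open Literature.NumberTheory.EllipticCurves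

namespace Literature.NumberTheory.EllipticCurves.Rank1Residual

variable {W : WeierstrassCurve ℚ} [W.IsElliptic] [W.IsGloballyMinimal] {p : ℕ} [Fact p.Prime]

/-! ### Unpacking the class -/

omit [W.IsElliptic] in
/-- X11 pairs have multiplicative reduction at `p`. RESIDUAL-CASES §a.2 row X11. [folklore] -/
theorem ClassX11.mult (h : ClassX11 W p) : Mult W p := h.1

omit [W.IsElliptic] in
/-- X11 pairs have irreducible `E[p]`. RESIDUAL-CASES §a.2 row X11. [folklore] -/
theorem ClassX11.irr (h : ClassX11 W p) : Irr W p := h.2.1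

omit [W.IsElliptic] in
/-- **No X11 pair has good reduction at `p`** (multiplicative excludes good, Silverman *AEC* VII.5.1;
Mathlib `HasMultiplicativeReduction.not_hasGoodReduction`). Audit use: the standing hypothesis
"`p ∤ N`" (W. Zhang 2014, p. 193; Thm. 1.4 (4) "good ordinary"), "a prime of good ordinary
reduction" (Burungale–Castella–Skinner 2025 Thm. 1.1.2 / Cor. 1.3.1; Yan–Zhu 2026 Thm. 4.15) and
"a prime of good reduction (i.e., `p ∤ N`)" (Jetchev–Skinner–Wan 2017 Thm. 1.2.1) FAILS on the whole
class — in particular the census lever L4 (`bsd_p_of_X11_zhang`) has empty scope. [folklore] -/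
theorem ClassX11.not_good (h : ClassX11 W p) : ¬ Good W p :=
  WeierstrassCurve.HasMultiplicativeReduction.not_hasGoodReduction (R := ℤ_[p]) h.1

omit [W.IsElliptic] in
/-- Away from `p = 3`, an X11 pair is either without a second ramified multiplicative prime or of
analytic rank one with non-square-free conductor (the two disjuncts treated in this file).
RESIDUAL-CASES §a.2 row X11. [folklore] -/
theorem ClassX11.not_ram_or_rankOne_nonsemistable (h : ClassX11 W p) (hp3 : p ≠ 3) :
    ¬ Ram W p ∨ (W.analyticRank = 1 ∧ ¬ Semistable W) := by
  rcases h.2.2 with h1 | h2 | h3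
  · exact Or.inl h1
  · exact Or.inr h2
  · exact absurd h3.2 hp3

/-! ### Sub-classes deleted by PUBLISHED theorems -/

variable (W p) in
/-- **Sub-class `N_E < 5000` (in print).** For an X11 pair with `ord_{s=1} L(E,s) ≤ 1` and
conductor `< 5000`, `BSD(E,p)` holds — Miller, LMS J. Comput. Math. 14 (2011) Thm. 1.2 (with
Lawson–Wuthrich 2016 §5), a computer-assisted theorem for all `E/ℚ` with `r_an ≤ 1`, `N_E < 5000`
and `E[p]` irreducible, taken as the tree's named fact `bsdp_of_irreducible_of_conductor_lt`; X11
supplies `irr(p)`. A finite sub-class, not a class theorem.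
[cite: Miller2011LMS, Thm. 1.2] [cite: LawsonWuthrich2016, §5] -/
theorem bsdp_of_classX11_of_conductor_lt (hM : bsdp_of_irreducible_of_conductor_lt)
    (hr : W.analyticRank ≤ 1) (hX : ClassX11 W p) (hN : W.conductorNorm ℤ < 5000) : BSDp W p :=
  hM W hr hN p (Fact.out) hX.irr

variable (W p) in
/-- **Sub-class `r = 0 ∧ surj(p) ∧ ord_p #Ш_an = 0`, `p` odd (in print; census lever L1).** For an
X11 pair at an odd prime `p` with `L(E,1) ≠ 0`, `ρ̄_{E,p}` surjective and `#Ш(E/ℚ)_an` a rational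
number of `p`-adic valuation `0`, `BSD(E,p)` holds: Wuthrich, Doc. Math. 19 (2014) Prop. 21 — "`#Ш(E/ℚ)`
divides `C · (L(E,1)/Ω_E⁺) · (#E(ℚ))² / ∏_v c_v` where `C` is a rational number only divisible by
`2`, primes of additive reduction or primes for which the Galois representation on `E[p]` is neither
surjective nor contained in a Borel subgroup" (tree fact `Wuthrich2014.sha_dvd_analyticSha`, with the
literature seat's bridge `bsdp_of_L_one_ne_zero_of_padicValRat_shaAn_eq_zero`) — a multiplicative
`p` is not additive, so `p ∤ C` and `0 ≤ ord_p #Ш ≤ ord_p #Ш_an = 0`; Gross–Zagier–Kolyvagin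
(`rank_eq_analyticRank_of_analyticRank_le_one`) gives `rank = 0` and `Ш` finite. SUB-class only: the
`p ∣ #Ш_an` pairs and all rank-`1` pairs of X11 are untouched. [cite: Wuthrich2014, Prop. 21 (p. 400)] -/
theorem bsdp_of_classX11_rankZero_surj_of_shaAn_unit (hWu : Wuthrich2014.sha_dvd_analyticSha)
    (hGZK : rank_eq_analyticRank_of_analyticRank_le_one) (hp : p ≠ 2) (hX : ClassX11 W p)
    (hL : W.entireLFunction 1 ≠ 0) (hsurj : Surj W p)
    (hunit : ∃ q : ℚ, shaAn W = (q : ℂ) ∧ padicValRat p q = 0) : BSDp W p :=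
  Wuthrich2014.bsdp_of_L_one_ne_zero_of_padicValRat_shaAn_eq_zero hWu hGZK W p hp hL
    (WeierstrassCurve.HasMultiplicativeReduction.not_hasAdditiveReduction _ hX.mult) (Or.inr hsurj)
    hunit

/-! ### What the ANNOUNCED statements reach (conditional on explicitly labelled OPEN binders) -/

omit [W.IsElliptic] in
/-- The auxiliary-prime hypothesis of Castella's erratum Thm. A′ ("nonsplit multiplicative
reduction at some prime `q ≠ p` where `E[p]` is ramified") implies the census predicate `ram(p)`:
A′ never reaches the sub-class `X11 ∧ ¬ram(p)`. [claim: Castella2018Erratum, status: under-review] -/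
theorem ram_of_erratumAprime_hypothesis
    (hq : ∃ (q : ℕ) (_ : Fact q.Prime), q ≠ p ∧ W.HasMultiplicativeReductionAtPrime q ∧
      ¬ W.HasSplitMultiplicativeReductionAtPrime q ∧ ¬ p ∣ padicValInt q W.minimalDiscriminantInt) :
    Ram W p := by
  obtain ⟨q, hqp, hne, hmult, -, hram⟩ := hq
  exact ⟨q, hqp, hne, hmult, hram⟩

/-- Hypotheses (a)–(e) of Skinner–Zhang, arXiv:1407.1099 Thm. 1.1 imply `ram(p)` ((e) gives two
distinct multiplicative primes with `E[p]` ramified, at most one of which is `p`;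
`SkinnerZhang2014.Hypotheses.exists_ramified_ne`): Thm. 1.2 never reaches `X11 ∧ ¬ram(p)`.
[cite: SkinnerZhang2014, Thm. 1.1 (e) (arXiv:1407.1099v1 p. 1)] -/
theorem ram_of_skinnerZhang_hypotheses (h : SkinnerZhang2014.Hypotheses W p) : Ram W p := by
  obtain ⟨ℓ, hℓ, hne, hmult, hram⟩ := h.exists_ramified_ne
  exact ⟨ℓ, hℓ, hne, hmult, hram⟩

/-- On the sub-class `X11 ∧ ¬ram(p)` BOTH announced rank-one statements are silent: their
hypotheses are contradicted (bookkeeping corollary of the two lemmas above). [folklore] -/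
theorem not_skinnerZhang_and_not_erratumAprime_of_not_ram (hX : ¬ Ram W p) :
    ¬ SkinnerZhang2014.Hypotheses W p ∧
    ¬ (∃ (q : ℕ) (_ : Fact q.Prime), q ≠ p ∧ W.HasMultiplicativeReductionAtPrime q ∧
        ¬ W.HasSplitMultiplicativeReductionAtPrime q ∧ ¬ p ∣ padicValInt q W.minimalDiscriminantInt) :=
  ⟨fun h => hX (ram_of_skinnerZhang_hypotheses h), fun h => hX (ram_of_erratumAprime_hypothesis h)⟩

variable (W p) in
/-- **CONDITIONAL (OPEN binder: Castella's unrefereed erratum Thm. A′).** For an X11 pair of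
analytic rank one at `p ≥ 5` with a NONSPLIT multiplicative prime `q ≠ p` at which `E[p]` is ramified
and `E(ℚ_p)[p] = 0` — so inside the disjunct `r = 1 ∧ ¬sst` (or the erratum-struck covered row C4) —
`BSD(E,p)` follows from the explicitly labelled open hypothesis
`Castella2018.erratum_thmAprime_padicVal_bsd_rankOne_OPEN` (web erratum, n.d., to Camb. J. Math. 6
(2018); = arXiv:2409.01360v1 Thm. 3.1; proof via Fouquet–Wan arXiv:2107.13726 Thm. 4.41, unrefereed)
through the bridge `bsdp_of_padicVal_printShape` and Gross–Zagier–Kolyvagin. NOT a deletion: the class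
stays open; this records exactly which announced statement would delete which sub-locus.
[claim: Castella2018Erratum, status: under-review] -/
theorem bsdp_of_classX11_rankOne_of_erratumAprime_OPEN
    (hA' : Castella2018.erratum_thmAprime_padicVal_bsd_rankOne_OPEN)
    (hGZK : rank_eq_analyticRank_of_analyticRank_le_one)
    (hp : 5 ≤ p) (hX : ClassX11 W p) (hr : W.analyticRank = 1)
    (hq : ∃ (q : ℕ) (_ : Fact q.Prime), q ≠ p ∧ W.HasMultiplicativeReductionAtPrime q ∧
      ¬ W.HasSplitMultiplicativeReductionAtPrime q ∧ ¬ p ∣ padicValInt q W.minimalDiscriminantInt)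
    (htors : ∀ P : (W.baseChange ℚ_[p]).toAffine.Point, p • P = 0 → P = 0) : BSDp W p := by
  have hr1 : W.analyticRank ≤ 1 := le_of_eq hr
  obtain ⟨-, hfin⟩ := hGZK W hr1
  exact bsdp_of_padicVal_printShape W p hGZK hr1 hX.irr
    (hA' W p hp hX.mult hX.irr hq htors hr hfin)

variable (W p) in
/-- **CONDITIONAL (OPEN binder: Skinner–Zhang, arXiv:1407.1099v1 Thm. 1.2, unrefereed since
2014).** For `E/ℚ` of analytic rank one satisfying hypotheses (a)–(e) of Skinner–Zhang Thm. 1.1 at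
`p ≥ 5` (`SkinnerZhang2014.Hypotheses W p`: multiplicative `p`, `p ∤ ord_p(Δ)` and the `𝔏`-type
condition, `E[p]` irreducible, ramification at `ℓ ≡ ±1 (mod p)`, two ramified `ℓ ‖ N`; `N` may be
non-square-free, so this meets the disjunct `r = 1 ∧ ¬sst`), `BSD(E,p)` follows from the explicitly
labelled open hypothesis `SkinnerZhang2014.thm1_2_padicVal_bsd_rankOne_OPEN` through the bridge and
Gross–Zagier–Kolyvagin. NOT a deletion. [claim: SkinnerZhang2014, status: under-review] -/
theorem bsdp_of_skinnerZhang_OPEN (hSZ : SkinnerZhang2014.thm1_2_padicVal_bsd_rankOne_OPEN)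
    (hGZK : rank_eq_analyticRank_of_analyticRank_le_one)
    (hp : 5 ≤ p) (hH : SkinnerZhang2014.Hypotheses W p) (hr : W.analyticRank = 1) : BSDp W p := by
  have hr1 : W.analyticRank ≤ 1 := le_of_eq hr
  obtain ⟨-, hfin⟩ := hGZK W hr1
  exact bsdp_of_padicVal_printShape W p hGZK hr1 hH.irr (hSZ W p hp hH hr hfin)

/-- A pair satisfying Skinner–Zhang's hypotheses at `p ≠ 3` with analytic rank one lies in X11 iff
its conductor is not square-free (the (a)–(e) pairs with square-free `N` belong to the covered row
C4 — whose published source is under erratum — not to X11). Bookkeeping.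
[cite: SkinnerZhang2014, Thm. 1.1 (arXiv:1407.1099v1 p. 1)] -/
theorem classX11_of_skinnerZhang_hypotheses_iff (hH : SkinnerZhang2014.Hypotheses W p)
    (hr : W.analyticRank = 1) (hp3 : p ≠ 3) : ClassX11 W p ↔ ¬ Semistable W := by
  constructor
  · intro hX
    rcases hX.not_ram_or_rankOne_nonsemistable hp3 with h | h
    · exact absurd (ram_of_skinnerZhang_hypotheses hH) h
    · exact h.2
  · intro hns
    exact ⟨hH.mult, hH.irr, Or.inr (Or.inl ⟨hr, hns⟩)⟩

end Literature.NumberTheory.EllipticCurves.Rank1Residual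

end
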